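import Literature.NumberTheory.EllipticCurves.CoatesGreenberg1996.GoodModelKernelH1Trivial
import Literature.NumberTheory.EllipticCurves.Greenberg1999.KummerImageGoodOrdinaryModel
import Literature.NumberTheory.EllipticCurves.IwasawaSelmerSupersingularLocalProofs
import Summits.BirchSwinnertonDyer.Rank1Residual.X2.GreenbergVatsalSelmerLink
import Summits.BirchSwinnertonDyer.Rank1Residual.Additive.GordKummerIdentificationHigher
import HarnessLib

/-!
# S2 (Greenberg LNM 1716 Prop. 2.4 for a GOOD MODEL) — hence A239, A111 and every (G-ord) δ-input —
# DERIVED from the Coates–Greenberg good-model record `CoatesGreenberg1996.H1_goodModelKernel_trivial`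
# (row T-CG, cell `b2b-bsdres`, team n1011; seat n1011-p05 GEN 7)

HONEST FRAMING (cell `b2b-bsdres`, run/shared/lean/b2b/bsd-rank1-residual/, verbatim in every
file): the goal of the cell is to DELETE the COMBINATION-SHAPED residual classes of the
Birch–Swinnerton-Dyer formula for ALL analytic-rank `≤ 1` elliptic curves over `ℚ` — "full BSD
formula for every rank `≤ 1` curve in class `C`" assembled STRICTLY from published theorems — so
that the rank-`≤ 1` remainder becomes exactly the CONSTRUCTION-SHAPED classes, which are TYPED
(missing-input `Prop`s), NOT attempted. This is not "finishing BSD". Team n1011 (X4 ∧ `p = 3`,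
§I N10/N11; Route G δ-input on ALL (G-ord) rows): research route; TOOL theorems of Galois
cohomology; no definition, no NEW named fact in this file (the one published input is the record
`CoatesGreenberg1996.H1_goodModelKernel_trivial` of
`Literature/NumberTheory/EllipticCurves/CoatesGreenberg1996/GoodModelKernelH1Trivial.lean`, carried
as the hypothesis `hCG`, never dropped); nothing booked; no label changes. This is NOT a discharge of
S2: the Coates–Greenberg theorem (Tate–Sen almost-étale descent over deeply ramified fields) is not
proved in the tree; the file RE-SOURCES S2 (and through cc-typer-2's
`imKummer_ge_strictCondition_goodOrdinary_of_goodOrdinaryModel` A239, and through A239's file A111)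
to the SAME record from which the supersingular lane's (I2)
`WeierstrassCurve.CoatesGreenberg1996_H1_formalGroup_trivial` is derived (§2 of the record's file):
one independent published input fewer in the registry.

## What

* §1 `oneCocycleClass_mem_strictKer_iff` — cocycle criterion for the STRICT condition (the
  `decompIn` twin of X2's `oneCocycleClass_mem_greenbergKer_iff`).
* §2 **`imKummer_ge_strictCondition_goodOrdinaryModel_of_coatesGreenberg : hCG → S2`.** MECHANISM
  (Greenberg, LNM 1716 p. 83, "just as in the case of Kummer theory for the multiplicative group";
  Coates, LNM 1716 p. 37 (74)): let `c = [f] ∈ H¹(H, E[p^∞])` satisfy the strict condition at `v`: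
  `f mod C_v` is principal on `H ⊓ D_v`, say `≡ ∂m̄`, `m̄ = m mod C_v`. Restrict to the local group
  `G = H_v = {τ ∈ Γ_{ℚ_v} : res τ ∈ H}` and push into `E(K̄_v)`: the cocycle
  `ψ = ι∘f∘res − ∂(ι m)` takes values in `ι(C_v) ⊆ ker(red_{W₀} ∘ Φ_C) = Φ_C⁻¹(Ŵ₀(𝔪̄))` (`hN`,
  `hred`). `G` is closed (`H` is), lies below `(ker κ)_v` (`H ≤ ker κ`) and fixes `C` (`hHC`), so the
  record gives `ψ = ∂a`; hence `ι∘f∘res = ∂(a + ι m)` — the Kummer condition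
  (`oneCocycleClass_mem_localKerOver_iff`). S2's binders `hord` (ordinary) and `hHi` (finite index)
  are NOT used: the inclusion `Im λ ⊆ Im κ` holds at every layer above `ℚ_{v,∞}` and for every good
  model (Greenberg p. 83: at a supersingular prime `Im κ_K = H¹(K, E[p^∞])`).
* `imKummer_ge_strictCondition_goodOrdinary_of_coatesGreenberg : hCG → A239`.
* §3 class forms `ClassX4Gord.ramifiedLineKummerEqAt_of_coatesGreenberg (hCG) (hX)`,
  `ClassX3Gord.ramifiedLineKummerEqAt_of_coatesGreenberg (hCG) (hp2) (hX)` — K5's ENDs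
  `ClassX4Gord/ClassX3Gord.ramifiedLineKummerEqAt'` fed `hS2 := S2-of-hCG`: cc-typer-2's typed
  δ-input `RamifiedLineKummerEqAt W p` on ALL of X4♯(G-ord)/X3♯(G-ord), every odd `p`, is a theorem
  MOD THE COATES–GREENBERG RECORD ONLY.

References: J. Coates, R. Greenberg, Invent. Math. 124 (1996), Cor. 3.2, Thm. 2.13, Prop. 4.3
[CoatesGreenberg1996]; C.-Y. Lee, Math. Proc. Camb. Phil. Soc. 154 (2013) Thm. 2.4.2 [LeeCY2013] (cited through LNM 1716, label `CoGr-Cor3.2-via-LNM1716 (reported, primary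
unread; acq-06010)`); R. Greenberg, LNM 1716 (1999) §2 Prop. 2.4 (pp. 74–75), pp. 83–84; J. Coates,
LNM 1716 pp. 36–37 (74) [GreenbergLNM1716]; R. Greenberg, Adv. Stud. Pure Math. 17 (1989) p. 98
(strict Selmer condition) [Greenberg1989]; skeleton `cells/n1011/skel/T-CG.md` (4500050e72a3eb43).
-/

noncomputable section

open scoped Classical NNReal

open WeierstrassCurve

universe u


namespace Summit.BirchSwinnertonDyer.Rank1Residual.Additive.GoodModelLine

open NumberField IsDedekindDomain Field IsDedekindDomain.HeightOneSpectrum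
  Literature.NumberTheory.GaloisRepresentations Literature.NumberTheory.EllipticCurves
  Literature.NumberTheory.EllipticCurves.GreenbergSelmer
  Literature.NumberTheory.EllipticCurves.CoatesGreenberg1996
  Summit.BirchSwinnertonDyer.Rank1Residual.X2.GreenbergVatsalSelmerLink

/-! ## §1 Cocycle criterion for the strict condition -/

section Strict

variable {K : Type u} [Field K] [NumberField K] (H : Subgroup (absoluteGaloisGroup K))
  (M : Type u) [AddCommGroup M] [DistribMulAction (absoluteGaloisGroup K) M]
  [TopologicalSpace M] [DiscreteTopology M]

/-- **Cocycle criterion for the STRICT condition at `v ∣ p`**: the class of `f` lies in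
`N.strictKer H` iff `f mod M⁺_v` is principal on `H ⊓ D_v` with values in `M/M⁺_v`.
[cite: Greenberg1989, §1 p. 98] -/
theorem oneCocycleClass_mem_strictKer_iff {v : HeightOneSpectrum (𝓞 K)} (N : LocalDatum K M v)
    (f : contOneCocycles (discreteTopRep H M)) :
    oneCocycleClass (discreteTopRep H M) f ∈ N.strictKer H ↔
      ∃ q : N.Gr, ∀ x : decompIn H v, N.grMk (f.1 (decompInToH H v x)) = x • q - q := by
  rw [LocalDatum.mem_strictKer_iff, LocalDatum.strictMap, resH1Hom_oneCocycleClass,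
    oneCocycleClass_eq_zero_iff]
  rfl

end Strict

/-! ## §2 S2 from the Coates–Greenberg record -/

section Main

/-- **S2 DERIVED from the Coates–Greenberg good-model record: Greenberg's Prop. 2.4 (`Im λ_K ⊆ Im κ_K`)
for a GOOD ORDINARY MODEL `W₀ = C • E ⊗ K̄_v` at every layer `H ≤ ker κ` whose local group fixes `C`**
(`Greenberg1999.imKummer_ge_strictCondition_goodOrdinaryModel`, cc-typer-2 p285955), from
`H¹(L, Ŵ₀(𝔪̄)) = 0` (`hCG`): a strict class restricted to `H_v` is, modulo the coboundary of a lift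
`ι m` of the principalising class, a cocycle with values in `ι(C_v) ⊆ Φ_C⁻¹(Ŵ₀(𝔪̄))`, hence the
coboundary of some `a`, so the class is `∂(a + ι m)` in `H¹(H_v, E(K̄_v))`: the Kummer condition.
The binders `hord`, `hHi` of S2 are not used — in print: "for any deeply ramified extension
`𝔉/F`, we have `Im(κ_𝔉) = Im(λ_𝔉)`" (C.-Y. Lee 2013 Thm. 2.4.2 = [CoGr] Prop. 4.3, no reduction-type
hypothesis). [cite: GreenbergLNM1716, §2 Prop. 2.4 (pp. 74–75) and p. 83]
[cite: CoatesGreenberg1996, Cor. 3.2 and Prop. 4.3 (through GreenbergLNM1716, Coates p. 37 (74))]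
[cite: LeeCY2013, Thm. 2.4.2 (thesis version p. 43)] -/
theorem imKummer_ge_strictCondition_goodOrdinaryModel_of_coatesGreenberg
    (hCG : H1_goodModelKernel_trivial.{0}) :
    Greenberg1999.imKummer_ge_strictCondition_goodOrdinaryModel := by
  intro W _ p _ κ hκ v hpv w hw C W₀ hW₀ hΔ red hred _hord N hN H hHc hHκ _hHi hHC c hc
  obtain ⟨f, rfl⟩ := oneCocycleClass_surjective (discreteTopRep H (W.geomPrimaryTorsion p)) c
  obtain ⟨q, hq⟩ := (oneCocycleClass_mem_strictKer_iff H _ N f).1 hc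
  obtain ⟨m, rfl⟩ := N.grMk_surjective q
  -- notation
  set E := v.adicCompletion ℚ with hE
  set G : Subgroup (absoluteGaloisGroup E) := localSubgroup H E with hG
  set ι : W.geomPoints →+ localPoints W E := pointsMap W E with hι
  -- the pulled-back cocycle `F τ = ι (f (res τ))` on `G = H_v`
  set F : contOneCocycles (discreteTopRep G (localPoints W E)) :=
    contOneCocycles.pullback (resGalSubgroup H E)
      (resHomOfEquivariant (resGalSubgroup H E)
        ((pointsMap W E).comp (W.geomPrimaryTorsion p).subtype) fun τ P ↦ by
          simp only [AddMonoidHom.coe_comp, AddSubgroup.coe_subtype, Function.comp_apply,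
            Subgroup.smul_def, resGalSubgroup_apply_coe,
            Literature.NumberTheory.EllipticCurves.primaryComponent.coe_smul]
          exact pointsMap_smul W E τ P) f with hF
  have hFapply : ∀ τ : G, F.1 τ = ι ((f.1 (resGalSubgroup H E τ) : W.geomPrimaryTorsion p) :
      W.geomPoints) := fun τ ↦ rfl
  -- the coboundary of `ι m`
  have hcont : Continuous fun τ : G ↦ τ • ι (m : W.geomPoints) := by
    have hc : Continuous ((fun σ : absoluteGaloisGroup E ↦ σ • ι (m : W.geomPoints)) ∘
        (Subtype.val : G → absoluteGaloisGroup E)) :=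
      (continuous_smul_localPoints W E (ι (m : W.geomPoints))).comp continuous_subtype_val
    exact hc
  set ψ : contOneCocycles (discreteTopRep G (localPoints W E)) :=
    F - coboundaryCocycle (ι (m : W.geomPoints)) hcont with hψ
  -- each `τ ∈ H_v` gives an element of `H ⊓ D_v`
  have hyτ : ∀ τ : G, ∃ y : decompIn H v,
      decompInToH H v y = resGalSubgroup H E τ ∧
        ((y : decomp (K := ℚ) v) : absoluteGaloisGroup ℚ) = absGaloisRestrict ℚ E τ := by
    intro τ
    have hτH : absGaloisRestrict ℚ E τ ∈ H := (mem_localSubgroup_iff H E τ.1).1 τ.2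
    refine ⟨⟨⟨absGaloisRestrict ℚ E τ, (mem_decomp_iff v _).2 ⟨τ, rfl⟩⟩,
      (mem_decompIn_iff H v _).2 hτH⟩, Subtype.ext rfl, rfl⟩
  -- `ψ τ = ι (f (res τ) - (res τ • m - m))` and the bracket lies in `N.plus`
  have hψval : ∀ τ : G, ∃ n : W.geomPrimaryTorsion p, n ∈ N.plus ∧
      ψ.1 τ = ι (n : W.geomPoints) := by
    intro τ
    obtain ⟨y, hy, hy'⟩ := hyτ τ
    refine ⟨f.1 (resGalSubgroup H E τ) - (absGaloisRestrict ℚ E τ • m - m), ?_, ?_⟩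
    · have hym : y • N.grMk m = N.grMk (absGaloisRestrict ℚ E τ • m) := by
        rw [← hy']; rfl
      rw [← N.ker_grMk, AddMonoidHom.mem_ker, map_sub, map_sub, ← hy, hq y, hym]
      exact sub_self _
    · rw [hψ, cocycle_sub_apply, coboundaryCocycle_apply, hFapply]
      simp only [AddSubgroupClass.coe_sub, map_sub,
        Literature.NumberTheory.EllipticCurves.primaryComponent.coe_smul]
      have hsm : pointsMap W E (absGaloisRestrict ℚ E (τ : absoluteGaloisGroup E) •
            (m : W.geomPoints)) = τ • pointsMap W E (m : W.geomPoints) :=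
        pointsMap_smul W E (τ : absoluteGaloisGroup E) (m : W.geomPoints)
      rw [hsm]
  -- hence `ψ` has values in the kernel of reduction of the good model
  have hkernel : ∀ τ : G, Affine.Point.congrEquiv hW₀ (VariableChange.pointEquiv _ C
      (Affine.Point.congrEquiv (baseChange_baseChange_adicCompletion W v).symm (ψ.1 τ))) ∈
        kernelOfReduction W₀ (Valuation.integer.integers w) := by
    intro τ
    obtain ⟨n, hn, hψn⟩ := hψval τ
    rw [hψn, mem_kernelOfReduction_iff,
      ← goodReductionHom_eq_zero_iff (Valuation.integer.integers w) hΔ, ← hred]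
    exact (hN n).1 hn
  -- the local group `G = H_v`: closed, below `(ker κ)_v`, fixing `C`
  have hGc : IsClosed (G : Set (absoluteGaloisGroup E)) :=
    hHc.preimage (map_continuous (resGal (K := ℚ) E))
  have hGκ : G ≤ localSubgroup κ.kerSubgroup E := fun τ hτ ↦
    (mem_localSubgroup_iff _ E τ).2 (hHκ ((mem_localSubgroup_iff H E τ).1 hτ))
  have hGC : ∀ σ ∈ G,
      C.map ((absoluteGaloisGroup.toAlgEquiv E σ :
          AlgebraicClosure E ≃ₐ[E] AlgebraicClosure E) :
          AlgebraicClosure E →+* AlgebraicClosure E) = C := fun σ hσ ↦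
    hHC σ ((mem_localSubgroup_iff H E σ).1 hσ)
  -- Coates–Greenberg: `ψ` is the coboundary of some `a` in the kernel of reduction
  obtain ⟨a, -, hφa⟩ := hCG ℚ W p κ hκ v hpv w hw C W₀ hW₀ hΔ G hGc hGκ hGC ψ hkernel
  -- so `F = ∂(a + ι m)`: the Kummer condition
  refine (oneCocycleClass_mem_localKerOver_iff W p H E f).2 ⟨a + ι (m : W.geomPoints), fun τ ↦ ?_⟩
  have h := hφa τ
  rw [hψ, cocycle_sub_apply, coboundaryCocycle_apply, hFapply, sub_eq_iff_eq_add] at h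
  change ι _ = _
  rw [h, Subgroup.smul_def, Subgroup.smul_def, smul_add]
  abel

/-- **A239 DERIVED from the Coates–Greenberg record** (through S2: cc-typer-2's
`imKummer_ge_strictCondition_goodOrdinary_of_goodOrdinaryModel`): Greenberg's Prop. 2.4 for `E/ℚ`
good ordinary at `p`, the `hGrK` binder of the defect-2 R-D identifications (F8, p07's
`MixedCongruentPairGV`, F2/F7). [cite: GreenbergLNM1716, §2 Prop. 2.4 (pp. 74–75) and p. 83]
[cite: CoatesGreenberg1996, Cor. 3.2 (through GreenbergLNM1716)] -/
theorem imKummer_ge_strictCondition_goodOrdinary_of_coatesGreenberg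
    (hCG : H1_goodModelKernel_trivial.{0}) :
    Greenberg1999.imKummer_ge_strictCondition_goodOrdinary :=
  Greenberg1999.imKummer_ge_strictCondition_goodOrdinary_of_goodOrdinaryModel
    (imKummer_ge_strictCondition_goodOrdinaryModel_of_coatesGreenberg hCG)

end Main

/-! ## §3 Class forms: the δ-input on X4♯(G-ord) / X3♯(G-ord) mod the Coates–Greenberg record -/

section ClassForms

open Literature.NumberTheory.EllipticCurves.Rank1Residual
  Literature.NumberTheory.EllipticCurves.Rank1Residual.Typed

variable (W : WeierstrassCurve ℚ) [W.IsElliptic] [W.IsGloballyMinimal] (p : ℕ) [hp : Fact p.Prime]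

/-- **X4♯(G-ord), every odd `p`, no defect binder: the δ-input `RamifiedLineKummerEqAt W p` mod the
Coates–Greenberg record** (K5 `ClassX4Gord.ramifiedLineKummerEqAt'` fed `hS2 := S2-of-CoGr`).
X4♯(G-ord) stays CONSTRUCTION-SHAPED; nothing booked.
[cite: GreenbergLNM1716, §2 Prop. 2.4 (pp. 74–75), p. 83] [cite: CoatesGreenberg1996, Cor. 3.2 (through GreenbergLNM1716)] -/
theorem ClassX4Gord.ramifiedLineKummerEqAt_of_coatesGreenberg (hCG : H1_goodModelKernel_trivial.{0})
    (hX : ClassX4Gord W p) : RamifiedLineKummerEqAt W p :=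
  ClassX4Gord.ramifiedLineKummerEqAt'
    (imKummer_ge_strictCondition_goodOrdinaryModel_of_coatesGreenberg hCG) hX

/-- **X3♯(G-ord), every odd `p`: `RamifiedLineKummerEqAt W p` mod the Coates–Greenberg record**
(K5 `ClassX3Gord.ramifiedLineKummerEqAt'`). X3♯(G-ord) stays as labelled; nothing booked.
[cite: GreenbergLNM1716, §2 Prop. 2.4 (pp. 74–75), p. 83] [cite: CoatesGreenberg1996, Cor. 3.2 (through GreenbergLNM1716)] -/
theorem ClassX3Gord.ramifiedLineKummerEqAt_of_coatesGreenberg (hCG : H1_goodModelKernel_trivial.{0})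
    (hp2 : p ≠ 2) (hX : ClassX3Gord W p) : RamifiedLineKummerEqAt W p :=
  ClassX3Gord.ramifiedLineKummerEqAt'
    (imKummer_ge_strictCondition_goodOrdinaryModel_of_coatesGreenberg hCG) hp2 hX

end ClassForms

end Summit.BirchSwinnertonDyer.Rank1Residual.Additive.GoodModelLine

end
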